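import Summits.AtomisticToContinuum.Crystallization.Theorems.ChargedEnergyGapDualPriceStar
import HarnessLib

/-!
# DualPriceSwap (lens-3 g90, NODE 100, ed.2) — the ridge-OPTIMAL dual price `ySwap` from the landed `y⋆` by the axis-1 relabelling symmetry

FINDING «PRICE-SWAP» (decomp-a2c STATUS 2026-09-03T23:5xZ): the landed price `yStar` (NODE 96, `…DualPriceStarA` l.32) carries the two middle
prices in the order `(1,T) ↦ 32647/450000, (1,F) ↦ 955/18000`, which is the axis-1 mirror of the LP-optimal price at the ridge of (D¹)
(`tiltSext_apply`: `(1,T)` is the `439/485` tilt, `(1,F)` the `527/485` tilt).  `yStar` is dual feasible (proved) but its cap row is 5.8 % below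
the roof at the ridge (42.7 vs 45.3 c_T against a cost of 44.4 c_T), so the census needs the mirrored price

  `ySwap := sext (−781/6000) (−763/6000) (955/18000) (32647/450000) (917/18000) (917/18000)`.

No new 9744-inequality certificate is needed: dual feasibility is invariant under the relabelling group, and the axis-1 flip is in it.
* `flip1` — flip the Boolean on axis `1` only; `flip1_flip1` (involution); `relabel_flip1 : ∀ g σ, ∃ σ', ∀ p, relabel g σ (flip1 p) = relabel g σ' p` (`decide`).
* ★ `isRoofDualFeasible_flip1 : IsRoofDualFeasible T y → IsRoofDualFeasible T (y ∘ flip1)` (any table `T`).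
* `ySwap`, `ySwap_eq : ySwap = yStar ∘ flip1`, ★★★ `isRoofDualFeasible_T75_ySwap`, `capRow_ySwap`, `ySwap_le_roofVal` (as §96.3 for `y⋆`).
* §100.2 the WHOLE relabelling group (48 mirrors; ed.2): `axp_comp`, `sgn_comp`, `relabel_comp` (closure), `relabel_bijective`, `relabel_inv` (all `decide`),
  ★★ `isRoofDualFeasible_relabel : IsRoofDualFeasible T y → ∀ g₀ σ₀, IsRoofDualFeasible T (y ∘ relabel g₀ σ₀)` — e.g. the pole-swapped twin of `ySwap`
  (optimal on tilted cells, R2) and every axis permutation come for free; `isRoofDualFeasible_T75_ySwap_relabel`.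
Census usage: NODE 99 `capCell_lower … (hy := isRoofDualFeasible_T75_ySwap) …` with `y0T … y2F := −781/6000, −763/6000, 955/18000, 32647/450000, 917/18000, 917/18000`.
-/

noncomputable section
open scoped Classical
open Literature.MathematicalPhysics.StatisticalMechanics Literature.Geometry.DiscreteGeometry
open Summit.AtomisticToContinuum.Crystallization.Theses.PricedLinkCensus
open Summit.AtomisticToContinuum.Crystallization.Theorems.ChargedEnergyGapNegative

namespace Summit.AtomisticToContinuum.Crystallization.Theorems.ChargedEnergyGapChartDial

/-- Flip the Boolean label on axis `1` only (the relabelling `σ = (F,T,F)` with the identity axis permutation). -/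
def flip1 (p : Fin 3 × Bool) : Fin 3 × Bool := (p.1, if p.1 = 1 then !p.2 else p.2)

/-- `flip1` is an involution. [formal bookkeeping; lane docstring, hand-2 g43] -/
theorem flip1_flip1 (p : Fin 3 × Bool) : flip1 (flip1 p) = p := by
  rcases p with ⟨a, b⟩; fin_cases a <;> cases b <;> rfl

/-- The relabelling set is closed under the axis-1 flip: `relabel g σ ∘ flip1 = relabel g σ'` with `σ' = σ xor 2`. -/
theorem relabel_flip1 : ∀ (g : Fin 6) (σ : Fin 8), ∃ σ' : Fin 8, ∀ p : Fin 3 × Bool, relabel g σ (flip1 p) = relabel g σ' p := by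
  decide

/-- ★ Dual feasibility is invariant under the axis-1 flip of the price vector (any table). -/
theorem isRoofDualFeasible_flip1 {T : List ((Fin 3 × Bool → ℝ) × ℝ)} {y : Fin 3 × Bool → ℝ} (hy : IsRoofDualFeasible T y) :
    IsRoofDualFeasible T (y ∘ flip1) := by
  intro e he g σ
  obtain ⟨σ', hσ'⟩ := relabel_flip1 g σ
  have hperm : Function.Involutive flip1 := flip1_flip1
  calc ∑ p, (y ∘ flip1) p * e.1 (relabel g σ p)
      = ∑ p, y p * e.1 (relabel g σ (flip1 p)) := by
        refine Fintype.sum_equiv (hperm.toPerm flip1) _ _ (fun p => ?_)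
        simp only [Function.comp, Function.Involutive.coe_toPerm, flip1_flip1]
    _ = ∑ p, y p * e.1 (relabel g σ' p) := by simp_rw [hσ']
    _ ≤ e.2 := hy e he g σ'

/-- ★ The ridge-optimal dual price: `y⋆` with the two axis-1 prices in the `tiltSext` slot order (`(1,T)` = tilt `439/485`, `(1,F)` = tilt `527/485`). -/
def ySwap : Fin 3 × Bool → ℝ := sext (-(781 / 6000)) (-(763 / 6000)) (955 / 18000) (32647 / 450000) (917 / 18000) (917 / 18000)

/-- `ySwap` is `yStar` read through the axis-1 flip. [formal bookkeeping; lane docstring, hand-2 g43] -/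
theorem ySwap_eq : ySwap = yStar ∘ flip1 := by
  funext p; rcases p with ⟨a, b⟩
  fin_cases a <;> cases b <;> simp [ySwap, yStar, sext, flip1]

/-- ★★★ **`ySwap` IS DUAL FEASIBLE FOR `T75`** (from `isRoofDualFeasible_T75_yStar` by the flip symmetry; no new row certificates). -/
theorem isRoofDualFeasible_T75_ySwap : IsRoofDualFeasible T75 ySwap := by
  rw [ySwap_eq]; exact isRoofDualFeasible_flip1 isRoofDualFeasible_T75_yStar

/-- The same statement with the `sext` literal (the form NODE 99 `capCell_lower` consumes as `hy`). -/
theorem isRoofDualFeasible_T75_sext_swap :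
    IsRoofDualFeasible T75 (sext (-(781 / 6000)) (-(763 / 6000)) (955 / 18000) (32647 / 450000) (917 / 18000) (917 / 18000)) :=
  isRoofDualFeasible_T75_ySwap

/-- ★★★ **THE CAP ROW OF THE CENSUS AT `ySwap` (PROVED)**: for all parameters,
`κ(d)·unit/10 + κ(d)·(103/100)·(τ·2ρ)²·(Σ_p ySwap_p · tiltSext ϱ ρ d p) ≤ domCapK unit ϱ τ ρ d`. -/
theorem capRow_ySwap (unit ϱ τ ρ d : ℝ) :
    domKappa d * (unit / 10) + domKappa d * (103 / 100 * ((τ * (2 * ρ)) ^ 2 * ∑ p, ySwap p * tiltSext ϱ ρ d p)) ≤ domCapK unit ϱ τ ρ d :=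
  domCapK_ge_of_dualFeasible unit ϱ τ ρ d isRoofDualFeasible_T75_ySwap

/-- ★ Weak duality at `ySwap` for any non-negative weight vector. -/
theorem ySwap_le_roofVal {Wv : Fin 3 × Bool → ℝ} (h0 : ∀ p, 0 ≤ Wv p) : ∑ p, ySwap p * Wv p ≤ roofVal T75 Wv :=
  le_roofVal_T75_of_dualFeasible isRoofDualFeasible_T75_ySwap h0

/-- The zero price is dual feasible (table values are non-negative): the cap row `κ·unit/10` for cells where no positive price helps. -/
theorem isRoofDualFeasible_T75_zero : IsRoofDualFeasible T75 (sext 0 0 0 0 0 0) := by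
  intro e he g σ
  have h0 : ∀ p, sext (0 : ℝ) 0 0 0 0 0 p = 0 := by
    rintro ⟨a, b⟩; fin_cases a <;> cases b <;> simp [sext]
  simp only [h0, zero_mul, Finset.sum_const_zero]
  exact T75_values_nonneg e he

/-! §100.2 The whole relabelling group. -/

set_option maxHeartbeats 4000000 in
/-- closure of the axis permutations (`S₃`). -/
theorem axp_comp : ∀ g g₀ : Fin 6, ∃ g' : Fin 6, ∀ a : Fin 3, axp g (axp g₀ a) = axp g' a := by decide

set_option maxHeartbeats 4000000 in
/-- closure of the sign patterns, twisted by an axis permutation. -/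
theorem sgn_comp : ∀ (σ : Fin 8) (g₀ : Fin 6) (σ₀ : Fin 8), ∃ σ' : Fin 8, ∀ a : Fin 3, xor (sgn σ (axp g₀ a)) (sgn σ₀ a) = sgn σ' a := by decide

/-- ★ The 48 relabellings are closed under composition: `relabel g σ ∘ relabel g₀ σ₀ = relabel g' σ'`. -/
theorem relabel_comp (g : Fin 6) (σ : Fin 8) (g₀ : Fin 6) (σ₀ : Fin 8) :
    ∃ (g' : Fin 6) (σ' : Fin 8), ∀ p : Fin 3 × Bool, relabel g σ (relabel g₀ σ₀ p) = relabel g' σ' p := by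
  obtain ⟨g', hg'⟩ := axp_comp g g₀
  obtain ⟨σ', hσ'⟩ := sgn_comp σ g₀ σ₀
  refine ⟨g', σ', fun p => ?_⟩
  rcases p with ⟨a, b⟩
  simp only [relabel, hg' a, ← hσ' a, Bool.xor_assoc]

set_option maxHeartbeats 4000000 in
/-- Every relabelling `relabel g σ` is a bijection of `Fin 3 × Bool` (`decide`). [formal bookkeeping; lane docstring, hand-2 g43] -/
theorem relabel_bijective : ∀ (g : Fin 6) (σ : Fin 8), Function.Bijective (relabel g σ) := by decide

set_option maxHeartbeats 4000000 in
/-- every relabelling has an inverse relabelling. -/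
theorem relabel_inv : ∀ (g₀ : Fin 6) (σ₀ : Fin 8), ∃ (g₁ : Fin 6) (σ₁ : Fin 8), ∀ p, relabel g₁ σ₁ (relabel g₀ σ₀ p) = p := by decide

/-- ★★ Dual feasibility is invariant under the whole relabelling group: all 48 mirrors of a certified price are certified (any table). -/
theorem isRoofDualFeasible_relabel {T : List ((Fin 3 × Bool → ℝ) × ℝ)} {y : Fin 3 × Bool → ℝ} (hy : IsRoofDualFeasible T y)
    (g₀ : Fin 6) (σ₀ : Fin 8) : IsRoofDualFeasible T (y ∘ relabel g₀ σ₀) := by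
  intro e he g σ
  obtain ⟨g₁, σ₁, hinv⟩ := relabel_inv g₀ σ₀
  obtain ⟨g', σ', hcomp⟩ := relabel_comp g σ g₁ σ₁
  let r₀ : Fin 3 × Bool ≃ Fin 3 × Bool := Equiv.ofBijective _ (relabel_bijective g₀ σ₀)
  calc ∑ p, (y ∘ relabel g₀ σ₀) p * e.1 (relabel g σ p)
      = ∑ q, y q * e.1 (relabel g' σ' q) := by
        refine Fintype.sum_equiv r₀ _ _ (fun p => ?_)
        have h1 : relabel g σ p = relabel g' σ' (relabel g₀ σ₀ p) := by
          have := hcomp (relabel g₀ σ₀ p); rw [hinv] at this; exact this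
        simp only [Function.comp, h1, r₀, Equiv.ofBijective_apply]
    _ ≤ e.2 := hy e he g' σ'

/-- All 48 mirrors of `ySwap` are dual feasible for `T75` (e.g. `g₀ = 0, σ₀ = 1`: the pole-swapped twin). -/
theorem isRoofDualFeasible_T75_ySwap_relabel (g₀ : Fin 6) (σ₀ : Fin 8) : IsRoofDualFeasible T75 (ySwap ∘ relabel g₀ σ₀) :=
  isRoofDualFeasible_relabel isRoofDualFeasible_T75_ySwap g₀ σ₀

end Summit.AtomisticToContinuum.Crystallization.Theorems.ChargedEnergyGapChartDial

end
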